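import Summits.AtomisticToContinuum.Crystallization.Theorems.FrustratedLawDichotomyStrainedPatchHomLeafTableSoundHcpV
import Summits.AtomisticToContinuum.Crystallization.Theorems.FrustratedLawDichotomyStrainedPatchHomEntryTableHcp

/-!
# hcp vector-form leaf — the SCALED-FRAME CONVERSION `(U, ξ)`-box ↦ `(V, η)`-box and the term identity

decomp-a2c hand-2 g25 (crux `AperiodicFrustratedLawGap`, stmt-AtomisticToContinuum-27623; (H) hcp P-twin, critic rows 887/891/893).  The only place
where the irrational frame constants enter the vector-form leaf:

* §1 `κ = (1/2, √3/6, √(2/3))`, `κ⁻¹ = (2, 2√3, √(3/2))` in reals and in the fixed-point interval kernel `FI` (`kapF`, `kinvF`), `κ_c κ⁻¹_c = 1`;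
  the scaled frame `Vof U = U·diag(κ)` (entries `u_ac κ_c`) and scaled shuffle `etaof ξ = κ⁻¹ ξ`; ★ `lvOf c w : LV` — the per-leaf data of the
  entry/shuffle box `(c, w)` (centres/half-widths of the interval products), with ★ `lvOf_mem`: entries and shuffle in the box ⟹ `(Vof U, etaof ξ)`
  in the `LV` box;
* §2 ★ `qre_vof_false` / `qre_vof_true`: for a consistent record, `qre l (Vof U) (etaof ξ) = ‖latPt U hexFrame b‖²` (unshifted) resp.
  `‖latPt U hexFrame b + U (hcpShift + ξ)‖²` (shifted) — i.e. `p_b + u s = diag(κ) e`, `e = (2b₀ + b₁ + u, 3b₁ + u, 2b₂ + u)`.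

0 sorry; standard axioms.  `--supports stmt-AtomisticToContinuum-27623`.
-/

noncomputable section

namespace Summit.AtomisticToContinuum.Crystallization.Theorems.FrustratedLawDichotomyStrainedPatchHomLeafTableCheckHcpV

open scoped BigOperators RealInnerProductSpace
open Finset
open Literature.Analysis.ValidatedNumerics.Numerics
open Summit.AtomisticToContinuum.Crystallization.Theorems.ChargedEnergyGapNegative (E3)
open Summit.AtomisticToContinuum.Crystallization.Theorems.FrustratedLawDichotomyStrainedPatchHomSplit (latPt hexFrame hcpShift)
open Summit.AtomisticToContinuum.Crystallization.Theorems.FrustratedLawDichotomyStrainedPatchHomCoords (apply_eq_sum_entries)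
open Summit.AtomisticToContinuum.Crystallization.Theorems.FrustratedLawDichotomyStrainedPatchHomEntryGram (entryFI mem_entryFI cen rad abs_sub_cen_le)
open Summit.AtomisticToContinuum.Crystallization.Theorems.FrustratedLawDichotomyStrainedPatchHomEntryGramHcp
  (s3 s23 mem_s3 mem_s23 mem_half shufFI mem_shufFI hexFrame_apply₀ hexFrame_apply₁ hexFrame_apply₂ hcpShift_apply)
open Summit.AtomisticToContinuum.Crystallization.Theorems.FrustratedLawDichotomyStrainedPatchHomEntryTableHcp (coord_mem)
open Summit.AtomisticToContinuum.Crystallization.Theorems.FrustratedLawDichotomyStrainedPatchHomLeafTableCheckHcp (NH famZ NH.ok_iff NH.toLab)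

/-! ## §1. The frame constants, the conversion, and the box membership -/

/-- `κ = (1/2, √3/6, √(2/3))`. -/
def kapR : Fin 3 → ℝ := ![1 / 2, Real.sqrt 3 / 6, Real.sqrt (2 / 3)]

/-- `κ⁻¹ = (2, 2√3, √(3/2))`. -/
def kinvR : Fin 3 → ℝ := ![2, Real.sqrt 3 * 2, Real.sqrt (3 / 2)]

/-- `κ` in the kernel. -/
def kapF : Fin 3 → FI := ![FI.ofFrac 1 2, s3.divNat 6, s23]

/-- `κ⁻¹` in the kernel. -/
def kinvF : Fin 3 → FI := ![FI.ofInt 2, s3.mulInt 2, FI.sqrt (FI.ofFrac 3 2)]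

/-- [formal bookkeeping] -/
theorem mem_kapF (c : Fin 3) : FI.mem (kapR c) (kapF c) := by
  fin_cases c
  · exact mem_half
  · simpa [kapR, kapF] using FI.mem_divNat mem_s3 (n := 6) (by norm_num)
  · exact mem_s23

/-- [formal bookkeeping] -/
theorem mem_kinvF (c : Fin 3) : FI.mem (kinvR c) (kinvF c) := by
  fin_cases c
  · simpa [kinvR, kinvF] using FI.mem_ofInt 2
  · simpa [kinvR, kinvF] using FI.mem_mulInt mem_s3 2
  · simp only [kinvR, kinvF]
    exact FI.mem_sqrt (by have h := FI.mem_ofFrac 3 (q := 2) (by norm_num); norm_num at h; exact h)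

/-- `κ_c κ⁻¹_c = 1`. [formal bookkeeping] -/
theorem kap_mul_kinv (c : Fin 3) : kapR c * kinvR c = 1 := by
  fin_cases c
  · simp [kapR, kinvR]
  · simp only [kapR, kinvR, Fin.mk_one, Fin.isValue, Matrix.cons_val_one, Matrix.cons_val_zero]
    have h := Real.mul_self_sqrt (show (0 : ℝ) ≤ 3 by norm_num)
    nlinarith [h]
  · simp only [kapR, kinvR, Fin.reduceFinMk, Matrix.cons_val]
    rw [← Real.sqrt_mul (by norm_num : (0 : ℝ) ≤ 2 / 3)]
    norm_num

/-- The SCALED FRAME `V = U·diag(κ)`: `V_ac = u_ac κ_c`. -/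
def Vof (U : E3 →L[ℝ] E3) (a c : Fin 3) : ℝ := (U (EuclideanSpace.single c (1 : ℝ))) a * kapR c

/-- The SCALED SHUFFLE `η = κ⁻¹ ξ`. -/
def etaof (ξ : E3) (c : Fin 3) : ℝ := ξ c * kinvR c

/-- The interval of `V_ac` over the entry box. -/
def vF (c w : (Fin 3 × Fin 3) ⊕ Fin 3 → ℤ) (a c' : Fin 3) : FI :=
  (entryFI (fun ab => c (Sum.inl ab)) (fun ab => w (Sum.inl ab)) (a, c')).mul (kapF c')

/-- The interval of `η_c` over the shuffle box. -/
def eF (c w : (Fin 3 × Fin 3) ⊕ Fin 3 → ℤ) (c' : Fin 3) : FI := (shufFI c w c').mul (kinvF c')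

/-- ★ The per-leaf data of the vector-form leaf for the entry/shuffle box `(c, w)`. -/
def lvOf (c w : (Fin 3 × Fin 3) ⊕ Fin 3 → ℤ) : LV :=
  ⟨cen (vF c w 0 0), cen (vF c w 0 1), cen (vF c w 0 2), cen (vF c w 1 0), cen (vF c w 1 1), cen (vF c w 1 2),
   cen (vF c w 2 0), cen (vF c w 2 1), cen (vF c w 2 2),
   (rad (vF c w 0 0)).toNat, (rad (vF c w 0 1)).toNat, (rad (vF c w 0 2)).toNat, (rad (vF c w 1 0)).toNat, (rad (vF c w 1 1)).toNat,
   (rad (vF c w 1 2)).toNat, (rad (vF c w 2 0)).toNat, (rad (vF c w 2 1)).toNat, (rad (vF c w 2 2)).toNat,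
   cen (eF c w 0), cen (eF c w 1), cen (eF c w 2), (rad (eF c w 0)).toNat, (rad (eF c w 1)).toNat, (rad (eF c w 2)).toNat⟩

/-- [formal bookkeeping] -/
theorem lvOf_vZ (c w : (Fin 3 × Fin 3) ⊕ Fin 3 → ℤ) (a c' : Fin 3) : (lvOf c w).vZ a c' = cen (vF c w a c') := by
  fin_cases a <;> fin_cases c' <;> rfl

/-- [formal bookkeeping] -/
theorem lvOf_wN (c w : (Fin 3 × Fin 3) ⊕ Fin 3 → ℤ) (a c' : Fin 3) : (lvOf c w).wN a c' = (rad (vF c w a c')).toNat := by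
  fin_cases a <;> fin_cases c' <;> rfl

/-- [formal bookkeeping] -/
theorem lvOf_nZ (c w : (Fin 3 × Fin 3) ⊕ Fin 3 → ℤ) (c' : Fin 3) : (lvOf c w).nZ c' = cen (eF c w c') := by
  fin_cases c' <;> rfl

/-- [formal bookkeeping] -/
theorem lvOf_mN (c w : (Fin 3 × Fin 3) ⊕ Fin 3 → ℤ) (c' : Fin 3) : (lvOf c w).mN c' = (rad (eF c w c')).toNat := by
  fin_cases c' <;> rfl

/-- `toNat` relaxation with the `ℕ`-cast shape of the `LV` box. [formal bookkeeping] -/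
theorem coord_mem_nat {x : ℝ} {a b : ℤ} (h : |x - (a : ℝ) / SC| ≤ (b : ℝ) / SC) : |x - (a : ℝ) / SC| ≤ ((b.toNat : ℕ) : ℝ) / SC := by
  have := coord_mem h
  simpa only [Int.cast_natCast] using this

/-- ★ **ENTRIES/SHUFFLE IN THE BOX ⟹ `(V, η)` IN THE `LV` BOX.** [folklore: interval bookkeeping] -/
theorem lvOf_mem (U : E3 →L[ℝ] E3) (ξ : E3) {c w : (Fin 3 × Fin 3) ⊕ Fin 3 → ℤ}
    (hbox : ∀ ab : Fin 3 × Fin 3, |(U (EuclideanSpace.single ab.2 (1 : ℝ))) ab.1 - (c (Sum.inl ab) : ℝ) / SC| ≤ (w (Sum.inl ab) : ℝ) / SC)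
    (hξ : ∀ i : Fin 3, |ξ i - (c (Sum.inr i) : ℝ) / SC| ≤ (w (Sum.inr i) : ℝ) / SC) :
    (∀ a c', |Vof U a c' - (((lvOf c w).vZ a c' : ℤ) : ℝ) / SC| ≤ (((lvOf c w).wN a c' : ℕ) : ℝ) / SC) ∧
      (∀ c', |etaof ξ c' - (((lvOf c w).nZ c' : ℤ) : ℝ) / SC| ≤ (((lvOf c w).mN c' : ℕ) : ℝ) / SC) := by
  refine ⟨fun a c' => ?_, fun c' => ?_⟩
  · rw [lvOf_vZ, lvOf_wN]
    have hm : FI.mem (Vof U a c') (vF c w a c') :=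
      FI.mem_mul (mem_entryFI (c := fun ab => c (Sum.inl ab)) (w := fun ab => w (Sum.inl ab)) (hbox (a, c'))) (mem_kapF c')
    exact coord_mem_nat (abs_sub_cen_le hm)
  · rw [lvOf_nZ, lvOf_mN]
    have hm : FI.mem (etaof ξ c') (eF c w c') := FI.mem_mul (mem_shufFI (hξ c')) (mem_kinvF c')
    exact coord_mem_nat (abs_sub_cen_le hm)

/-! ## §2. ★ The term identity: `q = ‖U(p_b + u(s + ξ))‖²` -/

/-- `‖y‖² = Σ_a (y a)²` on `E3`. [formal bookkeeping] -/
theorem norm_sq_eq_sum_sq (y : E3) : ‖y‖ ^ 2 = ∑ a, (y a) ^ 2 := by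
  rw [EuclideanSpace.norm_sq_eq]
  exact Finset.sum_congr rfl fun a _ => by rw [Real.norm_eq_abs, sq_abs]

/-- Coordinates of a lattice vector `Σ bᵢ fᵢ` in the hexagonal frame. [formal bookkeeping] -/
theorem hexComb_apply (b : Fin 3 → ℤ) (j : Fin 3) :
    (∑ i : Fin 3, ((b i : ℤ) : ℝ) • hexFrame i) j = ((b 0 : ℤ) : ℝ) * hexFrame 0 j + ((b 1 : ℤ) : ℝ) * hexFrame 1 j + ((b 2 : ℤ) : ℝ) * hexFrame 2 j := by
  simp only [Fin.sum_univ_three, PiLp.add_apply, PiLp.smul_apply, smul_eq_mul]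

/-- The scaled-frame coordinates: `κ_j e_j + u ξ_j = (Σ bᵢ fᵢ)_j + u (s + ξ)_j` for `e = (2b₀ + b₁ + u, 3b₁ + u, 2b₂ + u)`. [formal bookkeeping] -/
theorem frame_coord (b : Fin 3 → ℤ) (u : ℝ) (ξ : E3) (j : Fin 3) :
    kapR j * (![2 * ((b 0 : ℤ) : ℝ) + (b 1 : ℤ) + u, 3 * ((b 1 : ℤ) : ℝ) + u, 2 * ((b 2 : ℤ) : ℝ) + u] j) + u * ξ j =
      (∑ i : Fin 3, ((b i : ℤ) : ℝ) • hexFrame i) j + u * (hcpShift + ξ) j := by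
  rw [hexComb_apply, PiLp.add_apply, hcpShift_apply, hexFrame_apply₀, hexFrame_apply₁, hexFrame_apply₂]
  fin_cases j
  · simp [kapR]; ring
  · simp [kapR]; ring
  · have h8 : Real.sqrt 8 = 2 * Real.sqrt 2 := by
      rw [show (8 : ℝ) = 2 ^ 2 * 2 by norm_num, Real.sqrt_mul (by norm_num), Real.sqrt_sq (by norm_num)]
    simp [kapR]; rw [h8]; ring

/-- The record's `e` read in reals. [formal bookkeeping] -/
theorem eZ_real {l : NH} (hl : l.ok = true) (j : Fin 3) :
    ((eZ l j : ℤ) : ℝ) = ![2 * ((l.b0 : ℤ) : ℝ) + (l.b1 : ℤ) + (famZ l.fam : ℝ), 3 * ((l.b1 : ℤ) : ℝ) + (famZ l.fam : ℝ),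
      2 * ((l.b2 : ℤ) : ℝ) + (famZ l.fam : ℝ)] j := by
  obtain ⟨-, hu, -⟩ := record_facts hl
  fin_cases j <;>
  · simp only [eZ, e0, e1, e2, Int.add_def, Int.mul_def, hu, Fin.zero_eta, Fin.isValue, Fin.mk_one, Fin.reduceFinMk, Matrix.cons_val_zero,
      Matrix.cons_val_one, Matrix.cons_val]
    push_cast; ring

/-- `(l.u : ℝ) = famZ fam`. [formal bookkeeping] -/
theorem u_real {l : NH} (hl : l.ok = true) : (l.u : ℝ) = ((famZ l.fam : ℤ) : ℝ) := by
  obtain ⟨-, hu, -⟩ := record_facts hl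
  exact_mod_cast hu

/-- ★ The vector-form value is the squared term length, general family bit: `qre l (Vof U) (etaof ξ) = ‖latPt U f b + φ • U(s + ξ)‖²`, `φ = famZ fam`.
[folklore] -/
theorem qre_vof {l : NH} (hl : l.ok = true) (U : E3 →L[ℝ] E3) (ξ : E3) :
    qre l (Vof U) (etaof ξ) = ‖latPt U hexFrame l.toLab + ((famZ l.fam : ℤ) : ℝ) • U (hcpShift + ξ)‖ ^ 2 := by
  rw [norm_sq_eq_sum_sq]
  unfold qre
  refine Finset.sum_congr rfl fun a _ => ?_
  congr 1
  -- the coordinate `a`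
  have hlin : (latPt U hexFrame l.toLab + ((famZ l.fam : ℤ) : ℝ) • U (hcpShift + ξ)) a =
      ∑ j : Fin 3, (U (EuclideanSpace.single j (1 : ℝ))) a * ((∑ i : Fin 3, ((l.toLab i : ℤ) : ℝ) • hexFrame i) j + ((famZ l.fam : ℤ) : ℝ) * (hcpShift + ξ) j) := by
    unfold latPt
    rw [PiLp.add_apply, PiLp.smul_apply, smul_eq_mul, apply_eq_sum_entries, apply_eq_sum_entries, Finset.mul_sum, ← Finset.sum_add_distrib]
    exact Finset.sum_congr rfl fun j _ => by ring
  rw [hlin]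
  refine Finset.sum_congr rfl fun j _ => ?_
  unfold Vof etaof
  have hb : l.toLab = ![l.b0, l.b1, l.b2] := rfl
  have hf := frame_coord l.toLab (((famZ l.fam : ℤ) : ℝ)) ξ j
  rw [eZ_real hl j, u_real hl]
  have e1 : (U (EuclideanSpace.single j (1 : ℝ))) a * kapR j * (![2 * ((l.b0 : ℤ) : ℝ) + (l.b1 : ℤ) + (famZ l.fam : ℝ),
      3 * ((l.b1 : ℤ) : ℝ) + (famZ l.fam : ℝ), 2 * ((l.b2 : ℤ) : ℝ) + (famZ l.fam : ℝ)] j + ((famZ l.fam : ℤ) : ℝ) * (ξ j * kinvR j)) =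
      (U (EuclideanSpace.single j (1 : ℝ))) a * (kapR j * (![2 * ((l.toLab 0 : ℤ) : ℝ) + (l.toLab 1 : ℤ) + (famZ l.fam : ℝ),
        3 * ((l.toLab 1 : ℤ) : ℝ) + (famZ l.fam : ℝ), 2 * ((l.toLab 2 : ℤ) : ℝ) + (famZ l.fam : ℝ)] j) + ((famZ l.fam : ℤ) : ℝ) * ξ j)
        + (U (EuclideanSpace.single j (1 : ℝ))) a * ((famZ l.fam : ℤ) : ℝ) * ξ j * (kapR j * kinvR j - 1) := by
    simp only [hb, Fin.isValue, Matrix.cons_val_zero, Matrix.cons_val_one, Matrix.cons_val]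
    ring
  rw [e1, kap_mul_kinv, hf]
  ring

/-- ★ Unshifted record: `qre = ‖latPt U f b‖²`. [folklore] -/
theorem qre_vof_false {l : NH} (hl : l.ok = true) (hf : l.fam = false) (U : E3 →L[ℝ] E3) (ξ : E3) :
    qre l (Vof U) (etaof ξ) = ‖latPt U hexFrame l.toLab‖ ^ 2 := by
  rw [qre_vof hl, hf]; simp [famZ]

/-- ★ Shifted record: `qre = ‖latPt U f b + U(s + ξ)‖²`. [folklore] -/
theorem qre_vof_true {l : NH} (hl : l.ok = true) (hf : l.fam = true) (U : E3 →L[ℝ] E3) (ξ : E3) :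
    qre l (Vof U) (etaof ξ) = ‖latPt U hexFrame l.toLab + U (hcpShift + ξ)‖ ^ 2 := by
  rw [qre_vof hl, hf]; simp [famZ]

end Summit.AtomisticToContinuum.Crystallization.Theorems.FrustratedLawDichotomyStrainedPatchHomLeafTableCheckHcpV

end
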